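import Literature.MathematicalPhysics.QuantumLattice.WilsonBlockHeatBathMarkov
import Literature.MathematicalPhysics.QuantumFieldTheory.ConstructiveQFTWave0Proofs
import HarnessLib

/-!
# Gauge covariance of the block heat-bath projections of the torus Wilson theory

Theorems only.  The gauge transformations `U ↦ U^g` of the torus act link by link, preserve the Wilson state
`μ = wilsonMeasure ρ β` (tree `wilsonMeasure_map_gaugeTransform_holds`) and every link σ-algebra `𝓕_S`; consequently
conditional expectations given `𝓕_S` — in particular the block heat-bath projections `E[· | 𝓕_{B_zᶜ}]` — commute with
the gauge group (Martinelli 1999 §3; Seiler LNP 159 §1 for the gauge vocabulary):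

* `condExp_comp_ae_eq_of_measurePreserving` — abstract: a conditional expectation commutes with a measure-preserving
  measurable equivalence mapping the conditioning σ-algebra to itself (uniqueness of conditional expectation);
* `condExp_linkSigma_comp_gaugeTransform` — `μ[F ∘ (·)^g | 𝓕_S] = μ[F | 𝓕_S] ∘ (·)^g` a.e.;
* `exists_isGaugeInvariant_version` — a bounded measurable function invariant a.e. under every gauge transformation has a
  bounded measurable EVERYWHERE gauge-invariant version (average over the compact gauge group `G^{sites}`, Fubini);
* `exists_isGaugeInvariant_version_condExp_linkSigma` — hence the heat-bath average `μ[F | 𝓕_S]` of a bounded measurable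
  gauge-invariant `F` has a bounded measurable gauge-invariant version: the block heat-bath projections preserve the
  gauge-invariant functions.

References: F. Martinelli, LNM 1717 (1999), §3; E. Seiler, LNP 159 (1982), §1.
-/

noncomputable section

open MeasureTheory
open Literature.MathematicalPhysics.QuantumFieldTheory

namespace Literature.MathematicalPhysics.QuantumLattice.WilsonBlockHeatBath

/-! ### Conditional expectations and measure-preserving symmetries -/

section Abstract

/-- **Conditional expectation commutes with a symmetry of the conditioning.** If `τ` is a measurable equivalence of a
finite measure space preserving `μ`, and both `τ` and `τ⁻¹` are measurable for the sub-σ-algebra `m`, then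
`μ[f ∘ τ | m] = μ[f | m] ∘ τ` a.e. for every integrable `f` (uniqueness of the conditional expectation: `μ[f|m] ∘ τ`
is `m`-measurable and has the right integrals on `m`-sets `A = τ⁻¹(τ A)`). [folklore] -/
theorem condExp_comp_ae_eq_of_measurePreserving {Ω : Type*} {m m0 : MeasurableSpace Ω} {μ : Measure Ω}
    [IsFiniteMeasure μ] (hm : m ≤ m0) (τ : Ω ≃ᵐ Ω) (hτ : MeasurePreserving τ μ μ)
    (hτm : Measurable[m, m] τ) (hτm' : Measurable[m, m] τ.symm) {f : Ω → ℝ} (hf : Integrable f μ) :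
    μ[f ∘ τ | m] =ᵐ[μ] (μ[f | m]) ∘ τ := by
  have hfτ : Integrable (f ∘ τ) μ := (hτ.integrable_comp_emb τ.measurableEmbedding).2 hf
  have hgτ : Integrable ((μ[f | m]) ∘ τ) μ :=
    (hτ.integrable_comp_emb τ.measurableEmbedding).2 integrable_condExp
  refine (ae_eq_condExp_of_forall_setIntegral_eq hm hfτ (fun s _ _ => hgτ.integrableOn) (fun s hs _ => ?_)
    ((stronglyMeasurable_condExp.comp_measurable hτm).aestronglyMeasurable)).symm
  have hs' : MeasurableSet[m] (τ.symm ⁻¹' s) := hτm' hs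
  have hss : s = τ ⁻¹' (τ.symm ⁻¹' s) := by
    ext x; simp only [Set.mem_preimage, MeasurableEquiv.symm_apply_apply]
  rw [hss]
  change ∫ x in τ ⁻¹' (τ.symm ⁻¹' s), (μ[f | m]) (τ x) ∂μ = ∫ x in τ ⁻¹' (τ.symm ⁻¹' s), f (τ x) ∂μ
  rw [hτ.setIntegral_preimage_emb τ.measurableEmbedding (μ[f | m]) (τ.symm ⁻¹' s),
    hτ.setIntegral_preimage_emb τ.measurableEmbedding f (τ.symm ⁻¹' s), setIntegral_condExp hm hf hs']

end Abstract

/-! ### Gauge transformations and link σ-algebras -/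

section Gauge

variable {G : Type} [Group G] [TopologicalSpace G] [IsTopologicalGroup G] [CompactSpace G]
  [MeasurableSpace G] [BorelSpace G] {N : ℕ}

omit [TopologicalSpace G] [IsTopologicalGroup G] [CompactSpace G] [MeasurableSpace G] [BorelSpace G] in
/-- Gauge transformations compose: `(U^{g'})^{g} = U^{g g'}` (Seiler LNP 159 §1). [folklore] -/
theorem gaugeTransform_gaugeTransform (g g' : Site 4 N → G) (U : GaugeConfig 4 N G) :
    gaugeTransform g (gaugeTransform g' U) = gaugeTransform (g * g') U := by
  funext e; simp only [gaugeTransform, Pi.mul_apply, mul_inv_rev]; group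

omit [TopologicalSpace G] [IsTopologicalGroup G] [CompactSpace G] [MeasurableSpace G] [BorelSpace G] in
/-- The gauge transformation by `g⁻¹` undoes the one by `g`. [folklore] -/
theorem gaugeTransform_inv_gaugeTransform (g : Site 4 N → G) (U : GaugeConfig 4 N G) :
    gaugeTransform g⁻¹ (gaugeTransform g U) = U := by
  rw [gaugeTransform_gaugeTransform, inv_mul_cancel]; funext e; simp [gaugeTransform]

omit [CompactSpace G] in
/-- Gauge transformations act link by link, hence are measurable from `𝓕_S` to `𝓕_S` for every link set `S`.
[folklore] -/
theorem measurable_linkSigma_gaugeTransform (S : Set (Edge 4 N)) (g : Site 4 N → G) :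
    Measurable[linkSigma S, linkSigma S] (gaugeTransform g : GaugeConfig 4 N G → GaugeConfig 4 N G) := by
  rw [linkSigma_eq_cylinderEvents, measurable_cylinderEvents_iff]
  intro e he
  exact ((measurable_cylinderEvent_apply (i := e) he).const_mul _).mul_const _

omit [CompactSpace G] in
/-- Gauge transformations are measurable for the product σ-algebra. [folklore] -/
theorem measurable_gaugeTransform (g : Site 4 N → G) :
    Measurable (gaugeTransform g : GaugeConfig 4 N G → GaugeConfig 4 N G) := by
  have := measurable_linkSigma_gaugeTransform (Set.univ : Set (Edge 4 N)) g
  rwa [linkSigma_univ] at this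

variable {Nρ : ℕ} (ρ : G →* Matrix (Fin Nρ) (Fin Nρ) ℂ) [NeZero N]

/-- **Gauge covariance of the heat-bath averages** (Martinelli 1999 §3 with Seiler LNP 159 §1): for the torus Wilson
state `μ` and every link set `S`, `μ[F ∘ (·)^g | 𝓕_S] = μ[F | 𝓕_S] ∘ (·)^g` a.e. — the gauge transformation preserves
`μ` (`wilsonMeasure_map_gaugeTransform_holds`) and `𝓕_S`. [cite: Martinelli1999, §3] -/
theorem condExp_linkSigma_comp_gaugeTransform (hρ : Continuous ρ) (β : ℝ) (S : Set (Edge 4 N))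
    (g : Site 4 N → G) {F : GaugeConfig 4 N G → ℝ} (hF : Integrable F (wilsonMeasure (d := 4) (L := N) ρ β)) :
    (wilsonMeasure (d := 4) (L := N) ρ β)[F ∘ gaugeTransform g | linkSigma S]
      =ᵐ[wilsonMeasure (d := 4) (L := N) ρ β]
        ((wilsonMeasure (d := 4) (L := N) ρ β)[F | linkSigma S]) ∘ gaugeTransform g := by
  haveI := isProbabilityMeasure_wilsonMeasure (d := 4) (L := N) (G := G) ρ hρ β
  set τ : GaugeConfig 4 N G ≃ᵐ GaugeConfig 4 N G :=
    { toFun := gaugeTransform g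
      invFun := gaugeTransform g⁻¹
      left_inv := fun U => gaugeTransform_inv_gaugeTransform g U
      right_inv := fun U => by simpa only [inv_inv] using gaugeTransform_inv_gaugeTransform g⁻¹ U
      measurable_toFun := measurable_gaugeTransform g
      measurable_invFun := measurable_gaugeTransform g⁻¹ } with hτ
  have hpres : MeasurePreserving τ (wilsonMeasure (d := 4) (L := N) ρ β) (wilsonMeasure (d := 4) (L := N) ρ β) :=
    ⟨measurable_gaugeTransform g, wilsonMeasure_map_gaugeTransform_holds (d := 4) (L := N) ρ β g⟩
  exact condExp_comp_ae_eq_of_measurePreserving (linkSigma_le S) τ hpres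
    (measurable_linkSigma_gaugeTransform S g) (measurable_linkSigma_gaugeTransform S g⁻¹) hF

end Gauge

/-! ### Averaging over the gauge group -/

section Averaging

variable {G : Type} [Group G] [TopologicalSpace G] [IsTopologicalGroup G] [CompactSpace G]
  [MeasurableSpace G] [BorelSpace G] [SecondCountableTopology G] {N : ℕ} [NeZero N]

/-- **Invariant versions by averaging over the compact gauge group**: a bounded measurable function `h` of the links
with `h ∘ (·)^g = h` `μ`-a.e. for every gauge transformation `g` (any s-finite `μ`) is `μ`-a.e. equal to the bounded
measurable, everywhere gauge-invariant function `U ↦ ∫ h(U^{g⁻¹}) dg` (Haar probability on `G^{sites}`; Fubini and the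
left invariance of Haar measure). [folklore] -/
theorem exists_isGaugeInvariant_version (μ : Measure (GaugeConfig 4 N G)) [SFinite μ]
    {h : GaugeConfig 4 N G → ℝ} (hm : Measurable h) {B : ℝ} (hB : ∀ U, |h U| ≤ B)
    (hinv : ∀ g : Site 4 N → G, h ∘ gaugeTransform g =ᵐ[μ] h) :
    ∃ h' : GaugeConfig 4 N G → ℝ, Measurable h' ∧ (∀ U, |h' U| ≤ B) ∧ IsGaugeInvariant h' ∧ h' =ᵐ[μ] h := by
  set ν : Measure (Site 4 N → G) := Measure.pi fun _ => haarProbability G with hν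
  -- joint measurability of the action
  have hΦ : Measurable fun q : (Site 4 N → G) × GaugeConfig 4 N G => gaugeTransform q.1⁻¹ q.2 := by
    refine measurable_pi_lambda _ fun e => ?_
    simp only [gaugeTransform, Pi.inv_apply, inv_inv]
    exact ((((measurable_pi_apply e.1).comp measurable_fst).inv).mul
      ((measurable_pi_apply e).comp measurable_snd)).mul ((measurable_pi_apply _).comp measurable_fst)
  have hjoint : Measurable fun q : (Site 4 N → G) × GaugeConfig 4 N G => h (gaugeTransform q.1⁻¹ q.2) :=
    hm.comp hΦ
  refine ⟨fun U => ∫ g, h (gaugeTransform g⁻¹ U) ∂ν,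
    (hjoint.stronglyMeasurable.integral_prod_left' (μ := ν)).measurable, fun U => ?_, fun g' U => ?_, ?_⟩
  · -- bound
    have := norm_integral_le_of_norm_le_const (μ := ν) (f := fun g => h (gaugeTransform g⁻¹ U)) (C := B)
      (ae_of_all _ fun g => by rw [Real.norm_eq_abs]; exact hB _)
    rwa [Real.norm_eq_abs, probReal_univ, mul_one] at this
  · -- invariance: left invariance of the Haar measure of `G^{sites}`
    have hrw : ∀ g : Site 4 N → G, h (gaugeTransform g⁻¹ (gaugeTransform g' U)) =
        (fun k : Site 4 N → G => h (gaugeTransform k⁻¹ U)) (g'⁻¹ * g) := fun g => by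
      simp only [gaugeTransform_gaugeTransform, mul_inv_rev, inv_inv]
    simp_rw [hrw]
    exact integral_mul_left_eq_self (fun k : Site 4 N → G => h (gaugeTransform k⁻¹ U)) g'⁻¹
  · -- a.e. equality: Fubini
    have H1 : ∀ᵐ g ∂ν, ∀ᵐ U ∂μ, h (gaugeTransform g⁻¹ U) = h U :=
      ae_of_all _ fun g => hinv g⁻¹
    have hmeas : MeasurableSet {q : (Site 4 N → G) × GaugeConfig 4 N G | h (gaugeTransform q.1⁻¹ q.2) = h q.2} :=
      measurableSet_eq_fun hjoint (hm.comp measurable_snd)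
    have H2 : ∀ᵐ U ∂μ, ∀ᵐ g ∂ν, h (gaugeTransform g⁻¹ U) = h U := (Measure.ae_ae_comm hmeas).1 H1
    filter_upwards [H2] with U hU
    rw [integral_congr_ae hU, integral_const, probReal_univ, one_smul]

variable {Nρ : ℕ} (ρ : G →* Matrix (Fin Nρ) (Fin Nρ) ℂ)

/-- **The block heat-bath projections preserve gauge-invariant functions** (Martinelli 1999 §3 with Seiler LNP 159
§1): for the torus Wilson state `μ`, every link set `S` and every bounded measurable gauge-invariant `F`, the heat-bath
average `μ[F | 𝓕_S]` has a bounded (same bound) measurable gauge-invariant version. [cite: Martinelli1999, §3] -/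
theorem exists_isGaugeInvariant_version_condExp_linkSigma (hρ : Continuous ρ) (β : ℝ) (S : Set (Edge 4 N))
    {F : GaugeConfig 4 N G → ℝ} (hFm : Measurable F) {B : ℝ} (hB : ∀ U, |F U| ≤ B) (hFi : IsGaugeInvariant F) :
    ∃ F₁ : GaugeConfig 4 N G → ℝ, Measurable F₁ ∧ (∀ U, |F₁ U| ≤ B) ∧ IsGaugeInvariant F₁ ∧
      F₁ =ᵐ[wilsonMeasure (d := 4) (L := N) ρ β] (wilsonMeasure (d := 4) (L := N) ρ β)[F | linkSigma S] := by
  haveI := isProbabilityMeasure_wilsonMeasure (d := 4) (L := N) (G := G) ρ hρ β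
  set μ := wilsonMeasure (d := 4) (L := N) ρ β with hμ
  obtain ⟨h, hm, hb, -, hae⟩ := exists_version_condExp_linkSigma (N := N) ρ β S hB
  have hFint : Integrable F μ := Integrable.of_bound hFm.aestronglyMeasurable B
    (ae_of_all _ fun U => by rw [Real.norm_eq_abs]; exact hB U)
  have hinv : ∀ g : Site 4 N → G, h ∘ gaugeTransform g =ᵐ[μ] h := by
    intro g
    have hq : Measure.QuasiMeasurePreserving (gaugeTransform g) μ μ :=
      (⟨measurable_gaugeTransform g, wilsonMeasure_map_gaugeTransform_holds (d := 4) (L := N) ρ β g⟩ :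
        MeasurePreserving (gaugeTransform g) μ μ).quasiMeasurePreserving
    have h1 : h ∘ gaugeTransform g =ᵐ[μ] (μ[F | linkSigma S]) ∘ gaugeTransform g := hq.ae_eq_comp hae
    have h2 := condExp_linkSigma_comp_gaugeTransform ρ hρ β S g hFint
    have hFg : F ∘ gaugeTransform g = F := funext fun U => hFi g U
    rw [hFg] at h2
    exact h1.trans (h2.symm.trans hae.symm)
  obtain ⟨h', hm', hb', hi', hae'⟩ := exists_isGaugeInvariant_version μ hm hb hinv
  exact ⟨h', hm', hb', hi', hae'.trans hae⟩

end Averaging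

end Literature.MathematicalPhysics.QuantumLattice.WilsonBlockHeatBath

end
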